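import Mathlib
import Summits.ValiantsHypothesis.ValiantsHypothesis.Theses.DivisionGap
import Literature.Computability.AlgebraicComplexity.BirkhoffShadow
import Literature.Computability.AlgebraicComplexity.BirkhoffShadowProofs
import Literature.Computability.AlgebraicComplexity.BirkhoffShadowLowerBound

/-!
# Sketch — crux-ideate ShadowBirkhoff (stmt-ValiantsHypothesis-5069), ideator 3 (gen 2)

First-lemma signatures for the idea card `vertex-design-duality` (they must elaborate; proofs are not
required at the ideation stage).

* `extreme_of_parabola_sq` — PROVED (sorry-free) — the PARABOLA CRITERION (sufficient direction,
  quadratic case, which is the one the line uses): if two linear functionals `B` (slope) and `A`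
  (intercept) satisfy `(B x)^2 ≤ A x` on all permutation matrices, then every touching value
  `s = B x` with `A x = s^2` is a distinct vertex of the shadow under `L = (B, A)` (supporting
  functional `y ↦ 2 s y₀ − y₁`, tree lemma `BirkhoffShadowLower.mem_extremePoints_convexHull_of_forall_lt`);
  so `σ(DS_n) ≥ #{touching slope values}`.  `extreme_of_parabola` is the same for a general strictly
  convex `φ` (signature only; needs a supporting line of `φ`).
* `no_coextreme_of_balanced_tournament` — PROVED (sorry-free) — the OBSTRUCTION direction (Farkas/Jensen, planar shadow of
  the edge-balance certificate): a nonnegative weighting of (defender, challenger) pairs that is balanced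
  in both coordinates overall and balanced in the slope coordinate per defender forbids all defenders from
  being strict lower-hull vertices against their challengers — whatever the intercepts.  Every dead line of
  this crux so far (exchange identity fwd+bwd = legit+legit, Minkowski additivity, odometer relays) is a
  two- or four-term instance.
* `ParabolaSkeleton` / `shadowBirkhoff_of_parabolaSkeleton` — the combinatorial deliverable the line
  aims at (2^K co-extreme perfect matchings inside a pattern on O(K²) indices) and its glue to the crux.
-/

namespace Summit.ValiantsHypothesis.ValiantsHypothesis.Cruxes.ShadowBirkhoff.Ideator3g2

open Literature.Computability.AlgebraicComplexity

/-- Parabola criterion (quadratic case): if `(B x)^2 ≤ A x` on all permutation matrices, every touching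
slope value is a distinct vertex of the shadow under `L = (B, A)`. -/
theorem extreme_of_parabola_sq {n : ℕ} (A B : (Fin n × Fin n → ℝ) →ₗ[ℝ] ℝ)
    (hge : ∀ x ∈ permMatrixPoints n, (B x) ^ 2 ≤ A x) :
    {s : ℝ | ∃ x ∈ permMatrixPoints n, B x = s ∧ A x = s ^ 2}.ncard ≤
      birkhoffShadowVertexCount (LinearMap.pi ![B, A]) := by
  classical
  set L : (Fin n × Fin n → ℝ) →ₗ[ℝ] (Fin 2 → ℝ) := LinearMap.pi ![B, A] with hL
  have hL0 : ∀ x, L x 0 = B x := by intro x; simp [hL]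
  have hL1 : ∀ x, L x 1 = A x := by intro x; simp [hL]
  set S : Set (Fin 2 → ℝ) := L '' permMatrixPoints n with hS
  have hfin : S.Finite := by
    rw [hS, HrubesYehudayoff2021Prop23.image_permMatrixPoints_eq_range]
    exact Set.finite_range _
  -- the touching point for slope value s
  let z : ℝ → (Fin 2 → ℝ) := fun s => ![s, s ^ 2]
  have hz0 : ∀ s, z s 0 = s := fun s => rfl
  have hz1 : ∀ s, z s 1 = s ^ 2 := fun s => rfl
  have hzL : ∀ x, A x = (B x) ^ 2 → z (B x) = L x := by
    intro x hx
    ext i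
    fin_cases i
    · simp [z, hL0]
    · simp [z, hL1, hx]
  -- supporting functional at s: y ↦ 2 s y₀ − y₁
  have hmem : ∀ s ∈ {s : ℝ | ∃ x ∈ permMatrixPoints n, B x = s ∧ A x = s ^ 2},
      z s ∈ (convexHull ℝ S).extremePoints ℝ := by
    rintro s ⟨x, hx, hBx, hAx⟩
    have hzs : z s = L x := by rw [← hBx]; exact hzL x (by rw [hAx, hBx])
    let l : (Fin 2 → ℝ) →L[ℝ] ℝ :=
      (2 * s) • ContinuousLinearMap.proj (R := ℝ) (φ := fun _ : Fin 2 => ℝ) 0 -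
        ContinuousLinearMap.proj (R := ℝ) (φ := fun _ : Fin 2 => ℝ) 1
    have hl : ∀ y : Fin 2 → ℝ, l y = 2 * s * y 0 - y 1 := by
      intro y
      simp [l]
    apply BirkhoffShadowLower.mem_extremePoints_convexHull_of_forall_lt l
    · exact ⟨x, hx, hzs.symm⟩
    · rintro y ⟨x', hx', rfl⟩ hne
      rw [hl, hl, hL0, hL1, hz0, hz1]
      have h1 := hge x' hx'
      by_cases hB : B x' = s
      · -- same slope value: then A x' > s^2 (else the points coincide)
        have hA : A x' ≠ s ^ 2 := by
          intro hA
          apply hne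
          rw [← hzL x' (by rw [hA, hB]), hB]
        have hA' : s ^ 2 < A x' := lt_of_le_of_ne (by rw [← hB]; exact h1) (Ne.symm hA)
        rw [hB]; nlinarith
      · have hsq : 0 < (B x' - s) ^ 2 := by
          have : B x' - s ≠ 0 := sub_ne_zero.mpr hB
          positivity
        nlinarith
  have hinj : Set.InjOn z {s : ℝ | ∃ x ∈ permMatrixPoints n, B x = s ∧ A x = s ^ 2} := by
    intro s _ s' _ h
    have := congrFun h 0
    simpa [hz0] using this
  have hfinE : ((convexHull ℝ S).extremePoints ℝ).Finite :=
    hfin.subset (extremePoints_convexHull_subset)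
  exact Set.ncard_le_ncard_of_injOn z hmem hinj hfinE


/-- FIRST LEMMA, general form (parabola criterion for any strictly convex `φ`; signature only).
`L = (B, A)`; all projected permutation matrices lie on or above the graph of `φ`; each touching slope
value is an exposed vertex (supporting line of `φ`), and distinct slope values give distinct vertices.
[folklore] -/
theorem extreme_of_parabola {n : ℕ} (A B : (Fin n × Fin n → ℝ) →ₗ[ℝ] ℝ) (φ : ℝ → ℝ)
    (hφ : StrictConvexOn ℝ Set.univ φ)
    (hge : ∀ x ∈ permMatrixPoints n, φ (B x) ≤ A x) :
    {s : ℝ | ∃ x ∈ permMatrixPoints n, B x = s ∧ A x = φ s}.ncard ≤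
      birkhoffShadowVertexCount (LinearMap.pi ![B, A]) := by
  sorry

/-- OBSTRUCTION LEMMA (balanced tournament ⇒ not co-extreme), planar form.  Defenders `P T`, challengers
`Q M` (points of the plane, first coordinate = slope value, second = intercept), weights `p T M ≥ 0` with
some positive weight; overall balance of both coordinates and per-defender balance of the slope
coordinate.  Then it is impossible that every defender strictly beats all its weighted challengers along
some supporting slope `m T`. [folklore] -/
theorem no_coextreme_of_balanced_tournament {ι κ : Type*} [Fintype ι] [Fintype κ]
    (P : ι → ℝ × ℝ) (Q : κ → ℝ × ℝ) (p : ι → κ → ℝ) (hp : ∀ T M, 0 ≤ p T M)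
    (hpos : ∃ T M, 0 < p T M)
    (hbal : ∑ T, ∑ M, p T M • (Q M - P T) = 0)
    (hslope : ∀ T, ∑ M, p T M * ((Q M).1 - (P T).1) = 0) :
    ¬ ∀ T, ∃ m : ℝ, ∀ M, 0 < p T M → (P T).2 - m * (P T).1 < (Q M).2 - m * (Q M).1 := by
  intro h
  choose m hm using h
  -- second coordinate of the balance
  have h2 : ∑ T, ∑ M, p T M * ((Q M).2 - (P T).2) = 0 := by
    have := congrArg Prod.snd hbal
    simpa [Prod.snd_sum, Prod.smul_snd, smul_eq_mul] using this
  -- each weighted margin is nonnegative, one is positive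
  have hterm : ∀ T M, 0 ≤ p T M * ((Q M).2 - (P T).2 - m T * ((Q M).1 - (P T).1)) := by
    intro T M
    rcases (hp T M).lt_or_eq with hlt | heq
    · have := hm T M hlt
      exact mul_nonneg (hp T M) (by linarith)
    · rw [← heq]; simp
  obtain ⟨T₀, M₀, h0⟩ := hpos
  have hstrict : 0 < p T₀ M₀ * ((Q M₀).2 - (P T₀).2 - m T₀ * ((Q M₀).1 - (P T₀).1)) := by
    have := hm T₀ M₀ h0
    exact mul_pos h0 (by linarith)
  have hsum_pos : 0 < ∑ T, ∑ M, p T M * ((Q M).2 - (P T).2 - m T * ((Q M).1 - (P T).1)) := by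
    apply lt_of_lt_of_le _ (Finset.single_le_sum (fun T _ => Finset.sum_nonneg (fun M _ => hterm T M))
      (Finset.mem_univ T₀))
    exact lt_of_lt_of_le hstrict (Finset.single_le_sum (fun M _ => hterm T₀ M) (Finset.mem_univ M₀))
  -- but the weighted margins telescope to the balance, which vanishes
  have hsum_zero : ∑ T, ∑ M, p T M * ((Q M).2 - (P T).2 - m T * ((Q M).1 - (P T).1)) = 0 := by
    have : ∀ T, ∑ M, p T M * ((Q M).2 - (P T).2 - m T * ((Q M).1 - (P T).1))
        = ∑ M, p T M * ((Q M).2 - (P T).2) - m T * ∑ M, p T M * ((Q M).1 - (P T).1) := by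
      intro T
      rw [Finset.mul_sum, ← Finset.sum_sub_distrib]
      refine Finset.sum_congr rfl fun M _ => by ring
    simp_rw [this, hslope, mul_zero, sub_zero]
    exact h2
  linarith

/-- Affine cost `∑_u (v u (ρ u)).1 + t · ∑_u (v u (ρ u)).2` of a permutation under a weight table
(slope table in the second coordinate). [folklore] -/
noncomputable def permCost {n : ℕ} (v : Fin n → Fin n → ℝ × ℝ) (ρ : Equiv.Perm (Fin n)) (t : ℝ) : ℝ :=
  (∑ u, (v u (ρ u)).1) + t * (∑ u, (v u (ρ u)).2)

/-- The combinatorial deliverable of the line: for some constant `C`, on every index set of size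
`n ≥ C (K+1)^2` there are a weight table `v`, a 0/1 pattern `Pat`, and `2^K` permutations inside the
pattern, each the STRICT unique minimiser of the affine cost at some parameter among all permutations
inside the pattern (intended instances: patterns + slopes found by the vertex-design LP — the rigid
even-cycle digit family of kit j012575 realises this for `K ≤ 3` only; the live proposal is the
identity-free k-flow arena; permutations outside the pattern are removed by penalties in the glue, tree
`BirkhoffShadowLower.embed`). -/
def ParabolaSkeleton : Prop :=
  ∃ C : ℕ, ∀ K n : ℕ, C * (K + 1) ^ 2 ≤ n →
    ∃ v : Fin n → Fin n → ℝ × ℝ, ∃ Pat : Fin n → Fin n → Prop,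
    ∃ ρs : Fin (2 ^ K) → Equiv.Perm (Fin n), ∃ ts : Fin (2 ^ K) → ℝ,
      (∀ k u, Pat u (ρs k u)) ∧
      ∀ k (ρ : Equiv.Perm (Fin n)), (∀ u, Pat u (ρ u)) → ρ ≠ ρs k →
        permCost v (ρs k) (ts k) < permCost v ρ (ts k)

/-- GLUE: the deliverable implies the crux (penalise off-pattern permutations, strict unique minimiser ⇒
extreme point via `mem_extremePoints_convexHull_of_forall_lt`, count with `le_ncard_of_injOn_range`, and
`2^K > 2^{(log₂ n + c)^c}` for `K ≈ √(n/C) - 1`, eventually in `n`). -/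
theorem shadowBirkhoff_of_parabolaSkeleton :
    ParabolaSkeleton →
      Summit.ValiantsHypothesis.ValiantsHypothesis.Theses.DivisionGap.ShadowBirkhoff := by
  sorry

end Summit.ValiantsHypothesis.ValiantsHypothesis.Cruxes.ShadowBirkhoff.Ideator3g2
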